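import Summits.CriticalPhenomena.PercolationContinuityZ3.Theorems.PercNearOneGluingNoHeavyLowerTailThreePointLBSwitching
import Summits.CriticalPhenomena.PercolationContinuityZ3.Theorems.PercNearOneGluingNoHeavyLowerTailFibreSwitching
import Mathlib.Tactic.FinCases
import Mathlib.Tactic.Ring
import Mathlib.Tactic.Linarith
import Mathlib.Tactic.NormNum
import HarnessLib

/-!
# `NoHeavyLowerTail` (stmt-CriticalPhenomena-4575) — THEOREM `M(SHK3⁺)` (fibre positivity of `3PT-LB = SHK3⁺`
# on every finite graph), I: the switchings are bijections of every fibre; the certificate's fibre sum is the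
# fibre sum of a function of the three types

Support file (new-inequality factory seat `prim-ineq-gen-1`, gen 6; `--supports stmt-CriticalPhenomena-4575`).
No named facts, no sorries.  Part II (`…FibreSwitchingSHK3`) contains the kernel, the finite symmetrisation
identity and the theorem; this part contains everything about configurations.

**Setting.**  `V` a finite vertex type, `D : Finset (Sym2 V)` a set of pairs, `a b c : V`.  A triple
`x = (x 0, x 1, x 2)` of configurations `x i ⊆ D` has the PROFILE `e ↦ #{i : e ∈ x i}`
(`FibreSwitching.profile`); the FIBRE of a profile `k` is the set of triples inside `D` with that profile
(`FibreSwitching.fibre D k`).  Each configuration has one of five three-point TYPES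
(`code`: `0 = Q = a|b|c`, `1 = Pa = bc|a`, `2 = Pb = ac|b`, `3 = Pc = ab|c`, `4 = T = abc`), and
`shk3Kernel` is the integer kernel (six times the symmetric trilinear form) of the cubic
`F = (q + u_a + u_b + u_c + 2t)(qt − u_au_b − u_au_c − u_bu_c) − u_au_bu_c` (`sum_shk3Kernel_mul`):
`{T,T,Q} ↦ 4`, `{T,Q,Q} ↦ 2`, `{T,Q,P} ↦ 1`, `{T,P,P'} ↦ −2`, `{Q,P,P'} ↦ −1`, `{P,P,P'} ↦ −2`,
`{Pa,Pb,Pc} ↦ −4` (`P ≠ P'` petal types), all other patterns `0`.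

**Theorem** (`fibre_shk3Kernel_nonneg`).  For every `D, a, b, c` and EVERY profile `k`,
`0 ≤ Σ_{x ∈ fibre D k} shk3Kernel (code x₀) (code x₁) (code x₂)`;
in the factory's counts of ordered fibre elements by type pattern this is
`4N_{TTQ} + 2N_{TQQ} + N_{TQP} ≥ 2N_{TPP'} + N_{QPP'} + 2N_{PPP'} + 4N_{PaPbPc}`.
Since the product weight of a triple is a nonnegative function of its profile, this is strictly finer than the
law-level theorem `F ≥ 0` (`ThreePointLB.threePointLB_PrW`, prim-lit-2 / prim-cert-2), which is recovered for
every weight vector at once (`sum_wt3W_shk3Kernel_nonneg`); in generating-function language it says that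
`(Z + F_T)·(F_T F_Q − F_aF_b − F_aF_c − F_bF_c) − F_aF_bF_c` has nonnegative coefficients, where `F_τ(z)` is the
generating polynomial of the configurations of type `τ` and `Z = Π_e (1 + z_e)`.  This was conjectured from
an exhaustive census (all 3-terminal multigraphs with ≤ 7 vertices and ≤ 10 edges, all profiles; factory
notes FINDING-7/8) and is, to our knowledge, the first fibre-positivity theorem for a cubic three-point
functional (the quadratic one, fibre positivity of the Aas–Gladkov form, is `AntipodalStrongHarris`).

**Proof** (factory FINDING-11: "switching certificates are fibre certificates").  The four switchings
`Φ₁…Φ₄` of the proof of `3PT-LB` (`ThreePointLB.phi1 … phi4`) are two-region splicings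
`DecisionTree.splice3`, hence edgewise copy-permuting injections of the triples inside `D`
(`DecisionTree.permutesCopies_splice3`, `splice3_injective`), hence bijections of every fibre
(`FibreSwitching.sum_fibre_comp_eq_of_injOn`; `sum_fibre_phi1 … sum_fibre_phi4`); so the fibre sum of the
pointwise certificate `S = λ₀ + Σᵢ λᵢ ∘ Φᵢ ≤ 0` (`ThreePointLB.cert_nonpos`) equals the fibre sum of the
UNswitched potential `Λ = λ₀ + Σᵢ λᵢ` (`sum_fibre_cert`), a function of the three types (`certU_eq`).  Fibres
are invariant under permuting the copies (`sum_fibre_comp_perm`), so that fibre sum is the fibre sum of the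
copy-symmetrisation of `Λ`, which is `−shk3Kernel` identically on type triples (`lamZ_symm`, a finite check —
the cubic identity `E[S] = −F` of the switching proof read coefficientwise).  Hence
`Σ_fibre shk3Kernel = −6 Σ_fibre S ≥ 0`.
-/

noncomputable section

namespace Summit.CriticalPhenomena.PercolationContinuityZ3.Theorems

namespace FibreSHK3

open Finset Literature.Probability.Percolation Literature.Probability.Percolation.DecisionTree
open Literature.Probability.Percolation.Gladkov
open FibreSwitching ThreePointLB
open scoped Classical

/-! ### Permuting the copies, and two-region splicings, are bijections of every fibre -/

section Generic

variable {ι : Type*} [DecidableEq ι]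

/-- Relabelling the three copies by a permutation `σ` of `Fin 3` is a bijection of every fibre (the profile
is a symmetric function of the three bits), so `Σ_{x ∈ fibre k} f (x ∘ σ) = Σ_{x ∈ fibre k} f x`. [this work] -/
theorem sum_fibre_comp_perm (D : Finset ι) (σ : Equiv.Perm (Fin 3)) (k : ι → ℕ) {M : Type*}
    [AddCommMonoid M] (f : (Fin 3 → Finset ι) → M) :
    ∑ x ∈ fibre D k, f (fun i => x (σ i)) = ∑ x ∈ fibre D k, f x := by
  refine sum_fibre_comp_eq_of_injOn (Φ := fun x => fun i => x (σ i)) ?_ ?_ ?_ k f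
  · intro x i
    exact ⟨σ, fun _ => Iff.rfl⟩
  · intro x hx
    rw [mem_triples] at hx ⊢
    exact fun i => hx (σ i)
  · intro x _ y _ h
    funext i
    have h' := congrFun h (σ.symm i)
    simpa using h'

/-- A two-region splicing `splice3 R S` with `R` self-determined and `S` disjoint from `R` and determined on
`R ∪ S` is a bijection of every fibre: `Σ_{x ∈ fibre k} f (splice3 R S x) = Σ_{x ∈ fibre k} f x`.
[cite: GladkovZimin2024, Lemma 4.2 (counting form, fibrewise)] -/
theorem sum_fibre_comp_splice3 {R S : Finset ι → Finset ι} (hR : SelfDetermined R)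
    (hSR : ∀ K, Disjoint (S K) (R K))
    (hS : ∀ K K', (∀ i ∈ R K ∪ S K, (i ∈ K ↔ i ∈ K')) → S K' = S K) (D : Finset ι) (k : ι → ℕ)
    {M : Type*} [AddCommMonoid M] (f : (Fin 3 → Finset ι) → M) :
    ∑ x ∈ fibre D k, f (splice3 R S x) = ∑ x ∈ fibre D k, f x :=
  sum_fibre_comp_eq_of_injOn (permutesCopies_splice3 hSR) (fun _ hx => splice3_mem_triples hx)
    (fun _ _ _ _ h => splice3_injective hR hSR hS h) k f

end Generic

variable {V : Type*}

/-! ### The four switchings of the `3PT-LB` proof are bijections of every fibre -/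

section Switchings

variable [Fintype V] [DecidableEq V] (D : Finset (Sym2 V)) (a b : V) (k : Sym2 V → ℕ) {M : Type*}
  [AddCommMonoid M] (f : (Fin 3 → Finset (Sym2 V)) → M)

/-- `Φ₁` (explore `K_a(X)`, exchange copies `0,1` there) is a bijection of every fibre. [this work] -/
theorem sum_fibre_phi1 : ∑ x ∈ fibre D k, f (phi1 a x) = ∑ x ∈ fibre D k, f x := by
  unfold phi1
  exact sum_fibre_comp_splice3 (selfDetermined_touch_cl a) (fun K => Finset.disjoint_empty_left _)
    (fun _ _ _ => rfl) D k f

/-- `Φ₂` (explore `K_b(X)`, exchange copies `0,2` there) is a bijection of every fibre. [this work] -/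
theorem sum_fibre_phi2 : ∑ x ∈ fibre D k, f (phi2 b x) = ∑ x ∈ fibre D k, f x := by
  unfold phi2
  refine sum_fibre_comp_splice3 (fun _ _ _ => rfl) (fun K => Finset.disjoint_empty_right _)
    (fun K K' h => ?_) D k f
  rw [cl_eq_of_agree fun e he => h e (Finset.mem_union_right _ he)]

/-- `Φ₃` (explore `K_a(X)` to copy `1`, then `K_b(X)` to copy `2`) is a bijection of every fibre. [this work] -/
theorem sum_fibre_phi3 : ∑ x ∈ fibre D k, f (phi3 a b x) = ∑ x ∈ fibre D k, f x := by
  unfold phi3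
  exact sum_fibre_comp_splice3 (selfDetermined_touch_cl a) (fun K => Finset.sdiff_disjoint)
    (touch_sdiff_congr a b) D k f

/-- `Φ₄` (the same with the two explorations in the other order; a two-region splicing conjugated by the
exchange of copies `1, 2`) is a bijection of every fibre. [this work] -/
theorem sum_fibre_phi4 : ∑ x ∈ fibre D k, f (phi4 a b x) = ∑ x ∈ fibre D k, f x := by
  set σ : Equiv.Perm (Fin 3) := Equiv.swap 1 2 with hσ
  set R : Finset (Sym2 V) → Finset (Sym2 V) := fun K => touch (cl K b) with hR
  set S : Finset (Sym2 V) → Finset (Sym2 V) := fun K => touch (cl K a) \ touch (cl K b) with hS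
  have hphi : ∀ x, phi4 a b x = fun j => splice3 R S (fun i => x (σ i)) (σ j) := fun x => rfl
  calc ∑ x ∈ fibre D k, f (phi4 a b x)
      = ∑ x ∈ fibre D k, (fun y => f (fun j => splice3 R S y (σ j))) (fun i => x (σ i)) :=
        sum_congr rfl fun x _ => by rw [hphi]
    _ = ∑ y ∈ fibre D k, f (fun j => splice3 R S y (σ j)) :=
        sum_fibre_comp_perm D σ k (fun y => f (fun j => splice3 R S y (σ j)))
    _ = ∑ y ∈ fibre D k, f (fun j => y (σ j)) :=
        sum_fibre_comp_splice3 (selfDetermined_touch_cl b) (fun K => Finset.sdiff_disjoint)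
          (touch_sdiff_congr b a) D k (fun y => f (fun j => y (σ j)))
    _ = ∑ y ∈ fibre D k, f y := sum_fibre_comp_perm D σ k f

end Switchings

/-! ### The fibre sum of the pointwise certificate is the fibre sum of the unswitched potential -/

section Cert

variable (a b c : V)

/-- The unswitched potential `Λ = λ₀ + λ₁ + λ₂ + λ₃ + λ₄` of the `3PT-LB` certificate: the nine box-event
indicators of `ThreePointLB.cert`, all read on the input triple `x` itself. [this work] -/
def certU (x : Fin 3 → Finset (Sym2 V)) : ℝ :=
  - ind (box ((conn a b)ᶜ ∩ ((conn a c)ᶜ ∩ (conn b c)ᶜ)) Set.univ Set.univ) x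
  - ind (box ((conn a b)ᶜ ∩ ((conn a c)ᶜ ∩ (conn b c)ᶜ)) (conn b c ∩ (conn a b)ᶜ) (conn a c)) x
  + ind (box ((conn a b)ᶜ ∩ ((conn a c)ᶜ ∩ (conn b c)ᶜ)) (conn a b ∩ conn a c) (conn a c)ᶜ) x
  + ind (box (conn a c ∩ (conn a b)ᶜ) (conn a b ∩ conn a c) (conn a c)ᶜ) x
  + ind (box (conn b c)ᶜ (conn b c ∩ (conn a b)ᶜ) (conn a c)) x
  + ind (box (conn a c)ᶜ (conn b c ∩ (conn a b)ᶜ) (conn a c ∩ (conn a b)ᶜ)) x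
  - ind (box Set.univ (conn a b ∩ conn a c) ((conn a b)ᶜ ∩ ((conn a c)ᶜ ∩ (conn b c)ᶜ))) x
  + ind (box Set.univ (conn b c ∩ (conn a b)ᶜ) ((conn a c)ᶜ ∩ (conn b c)ᶜ)) x
  + ind (box Set.univ ((conn a c)ᶜ ∩ (conn b c)ᶜ) ((conn a b)ᶜ ∩ (conn b c)ᶜ)) x

variable [Fintype V] [DecidableEq V]

/-- **Fibrewise**, the certificate and the unswitched potential have the same sum:
`Σ_{x ∈ fibre k} S(x) = Σ_{x ∈ fibre k} Λ(x)` (each `λᵢ ∘ Φᵢ` is re-summed over the fibre through the bijection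
`Φᵢ`). [this work] -/
theorem sum_fibre_cert (D : Finset (Sym2 V)) (k : Sym2 V → ℕ) :
    ∑ x ∈ fibre D k, cert a b c x = ∑ x ∈ fibre D k, certU a b c x := by
  have h1 : ∀ E₀ E₁ E₂ : Set (Finset (Sym2 V)),
      ∑ x ∈ fibre D k, ind (box E₀ E₁ E₂) (phi1 a x) = ∑ x ∈ fibre D k, ind (box E₀ E₁ E₂) x :=
    fun E₀ E₁ E₂ => sum_fibre_phi1 D a k (ind (box E₀ E₁ E₂))
  have h2 : ∀ E₀ E₁ E₂ : Set (Finset (Sym2 V)),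
      ∑ x ∈ fibre D k, ind (box E₀ E₁ E₂) (phi2 b x) = ∑ x ∈ fibre D k, ind (box E₀ E₁ E₂) x :=
    fun E₀ E₁ E₂ => sum_fibre_phi2 D b k (ind (box E₀ E₁ E₂))
  have h3 : ∀ E₀ E₁ E₂ : Set (Finset (Sym2 V)),
      ∑ x ∈ fibre D k, ind (box E₀ E₁ E₂) (phi3 a b x) = ∑ x ∈ fibre D k, ind (box E₀ E₁ E₂) x :=
    fun E₀ E₁ E₂ => sum_fibre_phi3 D a b k (ind (box E₀ E₁ E₂))
  have h4 : ∀ E₀ E₁ E₂ : Set (Finset (Sym2 V)),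
      ∑ x ∈ fibre D k, ind (box E₀ E₁ E₂) (phi4 a b x) = ∑ x ∈ fibre D k, ind (box E₀ E₁ E₂) x :=
    fun E₀ E₁ E₂ => sum_fibre_phi4 D a b k (ind (box E₀ E₁ E₂))
  simp only [cert, certU, sum_add_distrib, sum_sub_distrib, sum_neg_distrib, h1, h2, h3, h4]

/-- The fibre sum of the unswitched potential is `≤ 0` (pointwise lemma `cert_nonpos` + `sum_fibre_cert`). [this work] -/
theorem sum_fibre_certU_nonpos (D : Finset (Sym2 V)) (k : Sym2 V → ℕ) :
    ∑ x ∈ fibre D k, certU a b c x ≤ 0 := by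
  rw [← sum_fibre_cert]
  exact sum_nonpos fun x _ => cert_nonpos a b c x

end Cert

/-! ### Three-point types and the potential as a function of the three types -/

section Types

variable (a b c : V)

/-- The three-point type of a configuration: `0 = Q = a|b|c`, `1 = Pa = bc|a`, `2 = Pb = ac|b`,
`3 = Pc = ab|c`, `4 = T = abc`. [this work] -/
def code (K : Finset (Sym2 V)) : Fin 5 :=
  if K ∈ conn a b then (if K ∈ conn a c then 4 else 3)
  else if K ∈ conn a c then 2 else if K ∈ conn b c then 1 else 0

/-- The five types exhaust the connection patterns of `a, b, c` (transitivity excludes "exactly two"), and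
`code` records which one holds. [folklore] -/
theorem code_cases (K : Finset (Sym2 V)) :
    (K ∉ conn a b ∧ K ∉ conn a c ∧ K ∉ conn b c ∧ code a b c K = 0) ∨
    (K ∉ conn a b ∧ K ∉ conn a c ∧ K ∈ conn b c ∧ code a b c K = 1) ∨
    (K ∉ conn a b ∧ K ∈ conn a c ∧ K ∉ conn b c ∧ code a b c K = 2) ∨
    (K ∈ conn a b ∧ K ∉ conn a c ∧ K ∉ conn b c ∧ code a b c K = 3) ∨
    (K ∈ conn a b ∧ K ∈ conn a c ∧ K ∈ conn b c ∧ code a b c K = 4) := by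
  have t1 : K ∈ conn a c → K ∈ conn b c → K ∈ conn a b :=
    fun hac hbc => mem_conn.2 ((mem_conn.1 hac).trans (mem_conn.1 hbc).symm)
  have t2 : K ∈ conn a b → K ∈ conn b c → K ∈ conn a c :=
    fun hab hbc => mem_conn.2 ((mem_conn.1 hab).trans (mem_conn.1 hbc))
  have t3 : K ∈ conn a b → K ∈ conn a c → K ∈ conn b c :=
    fun hab hac => mem_conn.2 ((mem_conn.1 hab).symm.trans (mem_conn.1 hac))
  unfold code
  by_cases hab : K ∈ conn a b <;> by_cases hac : K ∈ conn a c <;> by_cases hbc : K ∈ conn b c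
  · exact Or.inr (Or.inr (Or.inr (Or.inr ⟨hab, hac, hbc, by simp [hab, hac]⟩)))
  · exact absurd (t3 hab hac) hbc
  · exact absurd (t2 hab hbc) hac
  · exact Or.inr (Or.inr (Or.inr (Or.inl ⟨hab, hac, hbc, by simp [hab, hac]⟩)))
  · exact absurd (t1 hac hbc) hab
  · exact Or.inr (Or.inr (Or.inl ⟨hab, hac, hbc, by simp [hab, hac]⟩))
  · exact Or.inr (Or.inl ⟨hab, hac, hbc, by simp [hab, hac, hbc]⟩)
  · exact Or.inl ⟨hab, hac, hbc, by simp [hab, hac, hbc]⟩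

/-- Integer indicator of a finite set of types. [this work] -/
def chiZ (S : Finset (Fin 5)) (l : Fin 5) : ℤ := if l ∈ S then 1 else 0

variable {a b c}

/-- The indicator of an event that is a union of types is the type indicator of the code. [this work] -/
theorem ind_eq_chiZ {E : Set (Finset (Sym2 V))} {S : Finset (Fin 5)}
    (h : ∀ K, K ∈ E ↔ code a b c K ∈ S) (K : Finset (Sym2 V)) :
    ind E K = (chiZ S (code a b c K) : ℝ) := by
  unfold ind chiZ
  rw [h K]
  split_ifs <;> simp

variable (a b c)

/-- `Q = a|b|c` is type `0`. [this work] -/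
theorem mem_Q_iff (K : Finset (Sym2 V)) :
    K ∈ (conn a b)ᶜ ∩ ((conn a c)ᶜ ∩ (conn b c)ᶜ) ↔ code a b c K ∈ ({0} : Finset (Fin 5)) := by
  rcases code_cases a b c K with ⟨h1, h2, h3, hc⟩ | ⟨h1, h2, h3, hc⟩ | ⟨h1, h2, h3, hc⟩ |
    ⟨h1, h2, h3, hc⟩ | ⟨h1, h2, h3, hc⟩ <;>
  simp_all

/-- `Pa = bc|a` is type `1`. [this work] -/
theorem mem_Pa_iff (K : Finset (Sym2 V)) :
    K ∈ conn b c ∩ (conn a b)ᶜ ↔ code a b c K ∈ ({1} : Finset (Fin 5)) := by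
  rcases code_cases a b c K with ⟨h1, h2, h3, hc⟩ | ⟨h1, h2, h3, hc⟩ | ⟨h1, h2, h3, hc⟩ |
    ⟨h1, h2, h3, hc⟩ | ⟨h1, h2, h3, hc⟩ <;>
  simp_all

/-- `Pb = ac|b` is type `2`. [this work] -/
theorem mem_Pb_iff (K : Finset (Sym2 V)) :
    K ∈ conn a c ∩ (conn a b)ᶜ ↔ code a b c K ∈ ({2} : Finset (Fin 5)) := by
  rcases code_cases a b c K with ⟨h1, h2, h3, hc⟩ | ⟨h1, h2, h3, hc⟩ | ⟨h1, h2, h3, hc⟩ |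
    ⟨h1, h2, h3, hc⟩ | ⟨h1, h2, h3, hc⟩ <;>
  simp_all

/-- `T = abc` is type `4`. [this work] -/
theorem mem_T_iff (K : Finset (Sym2 V)) :
    K ∈ conn a b ∩ conn a c ↔ code a b c K ∈ ({4} : Finset (Fin 5)) := by
  rcases code_cases a b c K with ⟨h1, h2, h3, hc⟩ | ⟨h1, h2, h3, hc⟩ | ⟨h1, h2, h3, hc⟩ |
    ⟨h1, h2, h3, hc⟩ | ⟨h1, h2, h3, hc⟩ <;>
  simp_all

/-- `{a ~ c}` is types `{2, 4}`. [this work] -/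
theorem mem_ac_iff (K : Finset (Sym2 V)) :
    K ∈ conn a c ↔ code a b c K ∈ ({2, 4} : Finset (Fin 5)) := by
  rcases code_cases a b c K with ⟨h1, h2, h3, hc⟩ | ⟨h1, h2, h3, hc⟩ | ⟨h1, h2, h3, hc⟩ |
    ⟨h1, h2, h3, hc⟩ | ⟨h1, h2, h3, hc⟩ <;>
  simp_all

/-- `{a ≁ c}` is types `{0, 1, 3}`. [this work] -/
theorem mem_ac_compl_iff (K : Finset (Sym2 V)) :
    K ∈ (conn a c)ᶜ ↔ code a b c K ∈ ({0, 1, 3} : Finset (Fin 5)) := by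
  rcases code_cases a b c K with ⟨h1, h2, h3, hc⟩ | ⟨h1, h2, h3, hc⟩ | ⟨h1, h2, h3, hc⟩ |
    ⟨h1, h2, h3, hc⟩ | ⟨h1, h2, h3, hc⟩ <;>
  simp_all

/-- `{b ≁ c}` is types `{0, 2, 3}`. [this work] -/
theorem mem_bc_compl_iff (K : Finset (Sym2 V)) :
    K ∈ (conn b c)ᶜ ↔ code a b c K ∈ ({0, 2, 3} : Finset (Fin 5)) := by
  rcases code_cases a b c K with ⟨h1, h2, h3, hc⟩ | ⟨h1, h2, h3, hc⟩ | ⟨h1, h2, h3, hc⟩ |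
    ⟨h1, h2, h3, hc⟩ | ⟨h1, h2, h3, hc⟩ <;>
  simp_all

/-- `{c ≁ a, c ≁ b}` is types `{0, 3}`. [this work] -/
theorem mem_csep_iff (K : Finset (Sym2 V)) :
    K ∈ (conn a c)ᶜ ∩ (conn b c)ᶜ ↔ code a b c K ∈ ({0, 3} : Finset (Fin 5)) := by
  rcases code_cases a b c K with ⟨h1, h2, h3, hc⟩ | ⟨h1, h2, h3, hc⟩ | ⟨h1, h2, h3, hc⟩ |
    ⟨h1, h2, h3, hc⟩ | ⟨h1, h2, h3, hc⟩ <;>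
  simp_all

/-- `{b ≁ a, b ≁ c}` is types `{0, 2}`. [this work] -/
theorem mem_bsep_iff (K : Finset (Sym2 V)) :
    K ∈ (conn a b)ᶜ ∩ (conn b c)ᶜ ↔ code a b c K ∈ ({0, 2} : Finset (Fin 5)) := by
  rcases code_cases a b c K with ⟨h1, h2, h3, hc⟩ | ⟨h1, h2, h3, hc⟩ | ⟨h1, h2, h3, hc⟩ |
    ⟨h1, h2, h3, hc⟩ | ⟨h1, h2, h3, hc⟩ <;>
  simp_all

/-- The whole space is all types. [this work] -/
theorem mem_univ_iff (K : Finset (Sym2 V)) :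
    K ∈ (Set.univ : Set (Finset (Sym2 V))) ↔ code a b c K ∈ (Finset.univ : Finset (Fin 5)) := by
  simp

/-- A box event is the product of its three one-copy events. [folklore] -/
theorem ind_box (E₀ E₁ E₂ : Set (Finset (Sym2 V))) (x : Fin 3 → Finset (Sym2 V)) :
    ind (box E₀ E₁ E₂) x = ind E₀ (x 0) * ind E₁ (x 1) * ind E₂ (x 2) := by
  unfold ind
  simp only [mem_box]
  by_cases h0 : x 0 ∈ E₀ <;> by_cases h1 : x 1 ∈ E₁ <;> by_cases h2 : x 2 ∈ E₂ <;> simp [h0, h1, h2]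

/-- The unswitched potential as an integer table on type triples (the nine terms of `certU`). [this work] -/
def lamZ (l0 l1 l2 : Fin 5) : ℤ :=
  - chiZ {0} l0 * chiZ Finset.univ l1 * chiZ Finset.univ l2
  - chiZ {0} l0 * chiZ {1} l1 * chiZ {2, 4} l2
  + chiZ {0} l0 * chiZ {4} l1 * chiZ {0, 1, 3} l2
  + chiZ {2} l0 * chiZ {4} l1 * chiZ {0, 1, 3} l2
  + chiZ {0, 2, 3} l0 * chiZ {1} l1 * chiZ {2, 4} l2
  + chiZ {0, 1, 3} l0 * chiZ {1} l1 * chiZ {2} l2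
  - chiZ Finset.univ l0 * chiZ {4} l1 * chiZ {0} l2
  + chiZ Finset.univ l0 * chiZ {1} l1 * chiZ {0, 3} l2
  + chiZ Finset.univ l0 * chiZ {0, 3} l1 * chiZ {0, 2} l2

/-- The unswitched potential is a function of the three types: `Λ(x) = lamZ (code x₀) (code x₁) (code x₂)`. [this work] -/
theorem certU_eq (x : Fin 3 → Finset (Sym2 V)) :
    certU a b c x = (lamZ (code a b c (x 0)) (code a b c (x 1)) (code a b c (x 2)) : ℝ) := by
  simp only [certU, ind_box, ind_eq_chiZ (mem_Q_iff a b c), ind_eq_chiZ (mem_Pa_iff a b c),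
    ind_eq_chiZ (mem_Pb_iff a b c), ind_eq_chiZ (mem_T_iff a b c), ind_eq_chiZ (mem_ac_iff a b c),
    ind_eq_chiZ (mem_ac_compl_iff a b c), ind_eq_chiZ (mem_bc_compl_iff a b c),
    ind_eq_chiZ (mem_csep_iff a b c), ind_eq_chiZ (mem_bsep_iff a b c), ind_eq_chiZ (mem_univ_iff a b c),
    lamZ]
  push_cast
  ring

end Types

end FibreSHK3

end Summit.CriticalPhenomena.PercolationContinuityZ3.Theorems

end
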